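import Literature.NumberTheory.Automorphic.OrdinaryCompletedCohomologyGL
import Mathlib.NumberTheory.NumberField.InfinitePlace.Embeddings
import Mathlib.LinearAlgebra.Matrix.Charpoly.Eigs
import Mathlib.FieldTheory.IsAlgClosed.Spectrum
import Mathlib.Analysis.Complex.Polynomial.Basic
import HarnessLib

/-!
# Deep Hida levels are neat: torsion elements of `GL₂(F)` conjugate into `U(r)`, `r ≫ 0`, are trivial

Topic `NumberTheory/Automorphic`; namespace `Literature.NumberTheory.Automorphic`, grouping
sub-namespace `BigHeckeGLn.TameLevel` (the Hida tower `TameLevel.hidaLevel` of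
`OrdinaryCompletedCohomologyGL`).  Proof file (theorems only) supporting the named fact
`Literature.NumberTheory.Automorphic.hidaControl_dominantOrdinaryPoint` (Hida's control theorem in
consequence form, `BianchiOrdinaryClassicality`): the arithmetic groups
`Γ_g = GL₂(F) ∩ g U(r) g⁻¹` of the Hida levels `U(r)` are TORSION-FREE for `r ≥ r₀(F, p, v)`,
so that their cohomology vanishes above the virtual cohomological dimension and the all-degree
ordinary Hecke algebra `𝕋^{S,ord}(𝒰)` of the tree sees, at deep level, only the degrees of the
printed theory (Hida's condition (TF) "`Y(S)` is smooth … satisfied by sufficiently small `S`"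
[Hida1994AIF, §1 p. 1292]; Khare–Thorne's "sufficiently small" / good subgroups
[KhareThorne2017, §6.1]).

* `pow_eq_one_of_isRoot_charpoly`: a root of the characteristic polynomial of a matrix `M` with
  `M ^ m = 1` is an `m`-th root of unity (spectral mapping for `X ^ m`).
* `isIntegral_trace_of_pow_eq_one`, `norm_trace_le_of_pow_eq_one`: the trace of a complex matrix
  of finite order is an algebraic integer of absolute value `≤ n` (sum of the `n` roots of the
  characteristic polynomial, all on the unit circle).
* `trace_mem_of_pow_eq_one`, `det_mem_of_pow_eq_one`: for a number field `F`, the traces and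
  determinants of the torsion elements of `GL₂(F)` lie in the FINITE set
  `{t ∈ F | t integral, |φ(t)| ≤ 2 ∀ φ : F → ℂ}` (Mathlib `NumberField.Embeddings.finite_of_norm_le`).
* `eq_one_of_pow_eq_one_of_trace_eq_two_of_det_eq_one`: in characteristic `0`, a `2 × 2` matrix of
  finite order with trace `2` and determinant `1` is the identity (Cayley–Hamilton: `(M - 1)² = 0`,
  and `(1 + N)^m = 1 + m N`).
* `TameLevel.exists_forall_eq_one_of_isOfFinOrder`: **for a place `v ∣ p` there is `r₀` such that
  for all `r ≥ r₀`, every `γ ∈ GL₂(F)` of finite order with `g⁻¹ ι(γ) g ∈ U(r)` for some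
  `g ∈ GL₂(𝔸_F^∞)` is `1`** — the local component at `v` of `g⁻¹ ι(γ) g` lies in the Iwahori level
  `Iw_v(r, max r 1)` (diagonal entries `≡ 1`, lower-left entry `≡ 0 (mod ϖ_v^r)`), so
  `tr γ ≡ 2`, `det γ ≡ 1 (mod 𝔭_v^r)`; both lie in a finite set, hence `tr γ = 2`, `det γ = 1` once
  `r` exceeds the `v`-adic valuations of the finitely many non-zero differences.

## References

* H. Hida, *p-adic ordinary Hecke algebras for GL(2)*, Ann. Inst. Fourier 44 (1994), §1 p. 1292
  (condition (TF)) (held; read 2026-08-16). [Hida1994AIF]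
* C. Khare, J. A. Thorne, *Potential automorphy and the Leopoldt conjecture*, Amer. J. Math. 139
  (2017), §6.1 (good subgroups), §6.3 (arXiv:1409.7007, held; read 2026-08-16). [KhareThorne2017]
-/

noncomputable section

open scoped NumberField Polynomial
open IsDedekindDomain Polynomial

namespace Literature.NumberTheory.Automorphic

/-! ### Matrices of finite order: eigenvalues, trace, determinant -/

section FiniteOrder

variable {n : Type*} [Fintype n] [DecidableEq n]

/-- **A root of the characteristic polynomial of `M` with `M ^ m = 1` is an `m`-th root of unity**
(the root lies in the spectrum, and the spectrum of `M ^ m = 1` is `{1}`). [folklore] -/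
theorem pow_eq_one_of_isRoot_charpoly {K : Type*} [Field K] [Nonempty n] {M : Matrix n n K} {m : ℕ}
    (hM : M ^ m = 1) {r : K} (hr : M.charpoly.IsRoot r) : r ^ m = 1 := by
  have hmem : r ∈ spectrum K M := Matrix.mem_spectrum_of_isRoot_charpoly hr
  have h := spectrum.subset_polynomial_aeval M (X ^ m : K[X]) ⟨r, hmem, rfl⟩
  simp only [eval_pow, eval_X, map_pow, aeval_X, hM] at h
  rwa [spectrum.one_eq, Set.mem_singleton_iff] at h

/-- The characteristic polynomial of a complex matrix has `n` roots (with multiplicity). [folklore] -/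
theorem card_roots_charpoly_complex (M : Matrix n n ℂ) :
    Multiset.card M.charpoly.roots = Fintype.card n := by
  rw [splits_iff_card_roots.1 (IsAlgClosed.splits M.charpoly), Matrix.charpoly_natDegree_eq_dim]

/-- **The trace of a complex matrix of finite order is an algebraic integer** (a sum of roots of
unity). [folklore] -/
theorem isIntegral_trace_of_pow_eq_one {M : Matrix n n ℂ} {m : ℕ} (hm : 0 < m) (hM : M ^ m = 1) :
    IsIntegral ℤ M.trace := by
  rcases isEmpty_or_nonempty n with hn | hn
  · rw [Matrix.trace, Fintype.sum_empty]
    exact isIntegral_zero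
  rw [Matrix.trace_eq_sum_roots_charpoly]
  refine IsIntegral.multiset_sum fun r hr => IsIntegral.of_pow hm ?_
  rw [pow_eq_one_of_isRoot_charpoly hM ((mem_roots (Matrix.charpoly_monic M).ne_zero).1 hr)]
  exact isIntegral_one

/-- **The trace of a complex matrix of finite order has absolute value at most `n`** (its `n`
eigenvalues lie on the unit circle). [folklore] -/
theorem norm_trace_le_of_pow_eq_one {M : Matrix n n ℂ} {m : ℕ} (hm : 0 < m) (hM : M ^ m = 1) :
    ‖M.trace‖ ≤ Fintype.card n := by
  rcases isEmpty_or_nonempty n with hn | hn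
  · rw [Matrix.trace, Fintype.sum_empty, norm_zero]
    exact Nat.cast_nonneg _
  rw [Matrix.trace_eq_sum_roots_charpoly]
  calc ‖M.charpoly.roots.sum‖ ≤ (M.charpoly.roots.map fun r => ‖r‖).sum := norm_multiset_sum_le _
    _ = (M.charpoly.roots.map fun _ => (1 : ℝ)).sum := by
        congr 1
        refine Multiset.map_congr rfl fun r hr => ?_
        exact Complex.norm_eq_one_of_pow_eq_one
          (pow_eq_one_of_isRoot_charpoly hM ((mem_roots (Matrix.charpoly_monic M).ne_zero).1 hr))
          hm.ne'
    _ = Fintype.card n := by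
        rw [Multiset.map_const', Multiset.sum_replicate, nsmul_eq_mul, mul_one,
          card_roots_charpoly_complex]

/-- **Cayley–Hamilton for a `2 × 2` matrix of finite order with trace `2` and determinant `1`**:
such a matrix is the identity in characteristic `0` (`(M - 1)² = 0` and `(1 + N)^m = 1 + m N`).
[folklore] -/
theorem eq_one_of_pow_eq_one_of_trace_eq_two_of_det_eq_one {K : Type*} [Field K] [CharZero K]
    {M : Matrix (Fin 2) (Fin 2) K} {m : ℕ} (hm : 0 < m) (hM : M ^ m = 1) (htr : M.trace = 2)
    (hdet : M.det = 1) : M = 1 := by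
  set N : Matrix (Fin 2) (Fin 2) K := M - 1 with hN
  have hNsq : N * N = 0 := by
    have h := Matrix.aeval_self_charpoly M
    rw [Matrix.charpoly_fin_two, htr, hdet] at h
    simp only [map_sub, map_add, map_pow, aeval_X, map_mul, map_one, map_ofNat] at h
    rw [hN]
    calc (M - 1) * (M - 1) = M ^ 2 - 2 * M + 1 := by noncomm_ring
      _ = 0 := h
  have hpow : ∀ k : ℕ, (1 + N) ^ k = 1 + (k : ℕ) • N := fun k => by
    induction k with
    | zero => simp
    | succ k ih =>
      rw [pow_succ, ih, add_mul, one_mul, mul_add, mul_one, smul_mul_assoc, hNsq, smul_zero,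
        add_zero, add_assoc, succ_nsmul']
  have hMN : M = 1 + N := by rw [hN, add_sub_cancel]
  have h1 : (m : ℕ) • N = 0 := by
    have h := hpow m
    rw [← hMN, hM] at h
    exact (add_eq_left.1 h.symm)
  have hN0 : N = 0 := by
    ext i j
    have hij := congrFun (congrFun h1 i) j
    rw [Matrix.smul_apply, nsmul_eq_mul, Matrix.zero_apply, mul_eq_zero] at hij
    exact hij.resolve_left (Nat.cast_ne_zero.2 hm.ne')
  rw [hMN, hN0, add_zero]

end FiniteOrder

/-! ### Traces and determinants of torsion elements of `GL₂` over a number field -/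

section NumberField

variable {F : Type} [Field F] [NumberField F]

/-- For an embedding `φ : F → ℂ`, `φ(tr γ) = tr(φ γ)` and `(φ γ)^m = φ(γ^m)`: the trace of a
finite-order matrix over `F` is an algebraic integer all of whose conjugates have absolute value at
most `n`. [folklore] -/
theorem isIntegral_trace_and_norm_le {n : Type*} [Fintype n] [DecidableEq n] {M : Matrix n n F}
    {m : ℕ} (hm : 0 < m) (hM : M ^ m = 1) :
    IsIntegral ℤ M.trace ∧ ∀ φ : F →+* ℂ, ‖φ M.trace‖ ≤ Fintype.card n := by
  have hφ : ∀ φ : F →+* ℂ, (φ.mapMatrix M) ^ m = 1 ∧ φ M.trace = (φ.mapMatrix M).trace := fun φ =>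
    ⟨by rw [← map_pow, hM, map_one], by simp [Matrix.trace, map_sum]⟩
  refine ⟨?_, fun φ => ?_⟩
  · obtain ⟨φ⟩ : Nonempty (F →+* ℂ) := Fintype.card_pos_iff.1
      (by rw [NumberField.Embeddings.card F ℂ]; exact Module.finrank_pos)
    refine (isIntegral_algHom_iff φ.toIntAlgHom φ.injective).1 ?_
    change IsIntegral ℤ (φ M.trace)
    rw [(hφ φ).2]
    exact isIntegral_trace_of_pow_eq_one hm (hφ φ).1
  · rw [(hφ φ).2]
    exact norm_trace_le_of_pow_eq_one hm (hφ φ).1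

/-- **The trace of a torsion element of `GL₂(F)` lies in the finite set of algebraic integers of
house at most `2`.** [folklore] -/
theorem trace_mem_of_pow_eq_one {γ : Matrix (Fin 2) (Fin 2) F} {m : ℕ} (hm : 0 < m) (hγ : γ ^ m = 1) :
    γ.trace ∈ {t : F | IsIntegral ℤ t ∧ ∀ φ : F →+* ℂ, ‖φ t‖ ≤ 2} := by
  have h := isIntegral_trace_and_norm_le hm hγ
  exact ⟨h.1, fun φ => (h.2 φ).trans (by simp)⟩

omit [NumberField F] in
/-- **The determinant of a torsion element of `GL₂(F)` is a root of unity**, in particular an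
algebraic integer of house `1 ≤ 2`. [folklore] -/
theorem det_mem_of_pow_eq_one {γ : Matrix (Fin 2) (Fin 2) F} {m : ℕ} (hm : 0 < m) (hγ : γ ^ m = 1) :
    γ.det ∈ {t : F | IsIntegral ℤ t ∧ ∀ φ : F →+* ℂ, ‖φ t‖ ≤ 2} := by
  have hdet : γ.det ^ m = 1 := by rw [← Matrix.det_pow, hγ, Matrix.det_one]
  refine ⟨IsIntegral.of_pow hm (by rw [hdet]; exact isIntegral_one), fun φ => ?_⟩
  have h : φ γ.det ^ m = 1 := by rw [← map_pow, hdet, map_one]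
  rw [Complex.norm_eq_one_of_pow_eq_one h hm.ne']
  norm_num

/-- **A finite set of elements of `F` has `v`-adic valuations bounded below on its non-zero
members**: there is `r₀` with `|s|_v > |ϖ_v|^{r₀}` for all non-zero `s` in the set. [folklore] -/
theorem exists_forall_lt_valuation (v : HeightOneSpectrum (𝓞 F)) {S : Set F} (hS : S.Finite) :
    ∃ r₀ : ℕ, ∀ s ∈ S, s ≠ 0 → WithZero.exp (-(r₀ : ℤ)) < v.valuation F s := by
  classical
  refine ⟨hS.toFinset.sup fun s => (WithZero.log (v.valuation F s)).natAbs + 1, fun s hs hs0 => ?_⟩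
  have hne : v.valuation F s ≠ 0 := (Valuation.ne_zero_iff _).2 hs0
  have hle : (WithZero.log (v.valuation F s)).natAbs + 1 ≤
      hS.toFinset.sup fun s => (WithZero.log (v.valuation F s)).natAbs + 1 :=
    Finset.le_sup (f := fun s => (WithZero.log (v.valuation F s)).natAbs + 1) (hS.mem_toFinset.2 hs)
  rw [← WithZero.exp_log hne, WithZero.exp_lt_exp]
  omega

end NumberField

/-! ### Deep Hida levels are neat -/

namespace BigHeckeGLn.TameLevel

variable {F : Type} [Field F] [NumberField F] {p : ℕ} [Fact p.Prime] (𝒰 : TameLevel 2 F p)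

/-- **Deep Hida levels are neat.**  For a place `v ∣ p` there is `r₀` such that for every
`r ≥ r₀`, every `g ∈ GL₂(𝔸_F^∞)` and every `γ ∈ GL₂(F)` OF FINITE ORDER with `g⁻¹ ι(γ) g ∈ U(r)`
one has `γ = 1`; i.e. the arithmetic groups `Γ_g = GL₂(F) ∩ g U(r) g⁻¹` attached to the Hida
level `U(r)` (`TameLevel.hidaLevel`) are torsion-free — Hida's (TF) for sufficiently small `S`.
Proof: the `v`-component of `g⁻¹ ι(γ) g` lies in `Iw_v(r, max r 1)`, whose diagonal entries are
`≡ 1` and lower-left entry `≡ 0 (mod ϖ_v^r)`, so `|tr γ - 2|_v, |det γ - 1|_v ≤ |ϖ_v|^r`; traces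
and determinants of torsion elements form a finite set (`trace_mem_of_pow_eq_one`,
`det_mem_of_pow_eq_one`), so for `r ≥ r₀` (`exists_forall_lt_valuation`) `tr γ = 2`, `det γ = 1`,
whence `γ = 1` (`eq_one_of_pow_eq_one_of_trace_eq_two_of_det_eq_one`).
[cite: Hida1994AIF, §1 p. 1292 (condition (TF))] [cite: KhareThorne2017, §6.1] -/
theorem exists_forall_eq_one_of_isOfFinOrder {v : HeightOneSpectrum (𝓞 F)}
    (hv : (p : 𝓞 F) ∈ v.asIdeal) :
    ∃ r₀ : ℕ, ∀ r : ℕ, r₀ ≤ r → ∀ (g : FiniteAdelicGL 2 F) (γ : GL (Fin 2) F), IsOfFinOrder γ →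
      g⁻¹ * globalEmbedding 2 F γ * g ∈ 𝒰.hidaLevel r → γ = 1 := by
  classical
  set W : Set F := {t : F | IsIntegral ℤ t ∧ ∀ φ : F →+* ℂ, ‖φ t‖ ≤ 2} with hW
  have hWfin : W.Finite := NumberField.Embeddings.finite_of_norm_le F ℂ 2
  set D : Set F := (fun t => t - 2) '' W ∪ (fun t => t - 1) '' W with hD
  have hDfin : D.Finite := (hWfin.image _).union (hWfin.image _)
  obtain ⟨r₀, hr₀⟩ := exists_forall_lt_valuation v hDfin
  refine ⟨r₀, fun r hr g γ hγ hmem => ?_⟩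
  obtain ⟨m, hm, hγm⟩ := hγ.exists_pow_eq_one
  have hγm' : (γ : Matrix (Fin 2) (Fin 2) F) ^ m = 1 := by
    rw [← Units.val_pow_eq_pow_val, hγm, Units.val_one]
  -- the local component at `v` of `y = g⁻¹ ι(γ) g` and its Iwahori conditions
  set y : FiniteAdelicGL 2 F := g⁻¹ * globalEmbedding 2 F γ * g with hy
  obtain ⟨hA, -⟩ := mem_valuedIwahoriSubgroup_iff.1 (((𝒰.mem_hidaLevel_iff r y).1 hmem).2 v hv)
  set A : Matrix (Fin 2) (Fin 2) (v.adicCompletion F) :=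
    ((localComponent 2 F v y : GL (Fin 2) (v.adicCompletion F)) :
      Matrix (Fin 2) (Fin 2) (v.adicCompletion F)) with hAdef
  set Y : Matrix (Fin 2) (Fin 2) (FiniteAdeleRing (𝓞 F) F) :=
    ((y : FiniteAdelicGL 2 F) : Matrix (Fin 2) (Fin 2) (FiniteAdeleRing (𝓞 F) F)) with hYdef
  have hρ : ∀ t : WithZero (Multiplicative ℤ), t ≤ WithZero.exp (-(r : ℤ)) →
      t ≤ WithZero.exp (-(r₀ : ℤ)) := fun t ht =>
    ht.trans (WithZero.exp_le_exp.2 (by omega))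
  -- trace and determinant of `y` are those of `γ`
  have hιγ : ((globalEmbedding 2 F γ : FiniteAdelicGL 2 F) :
      Matrix (Fin 2) (Fin 2) (FiniteAdeleRing (𝓞 F) F)) =
        (γ : Matrix (Fin 2) (Fin 2) F).map (algebraMap F (FiniteAdeleRing (𝓞 F) F)) := rfl
  have hYtr : Y.trace = algebraMap F (FiniteAdeleRing (𝓞 F) F) (γ : Matrix (Fin 2) (Fin 2) F).trace := by
    rw [hYdef, hy, Units.val_mul, Units.val_mul, Matrix.trace_mul_cycle, ← Units.val_mul,
      mul_inv_cancel, Units.val_one, one_mul, hιγ, AddMonoidHom.map_trace]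
  have hYdet : Y.det = algebraMap F (FiniteAdeleRing (𝓞 F) F) (γ : Matrix (Fin 2) (Fin 2) F).det := by
    rw [hYdef, hy, Units.val_mul, Units.val_mul, Matrix.det_mul, Matrix.det_mul, mul_right_comm,
      ← Matrix.det_mul, ← Units.val_mul, inv_mul_cancel, Units.val_one, Matrix.det_one, one_mul,
      hιγ, RingHom.map_det, RingHom.mapMatrix_apply]
  have hAtr : A.trace = algebraMap F (v.adicCompletion F) (γ : Matrix (Fin 2) (Fin 2) F).trace := by
    have h : A.trace = AdelicGroupData.finiteAdeleEval F v Y.trace := by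
      rw [AddMonoidHom.map_trace]; rfl
    rw [h, hYtr]; rfl
  have hAdet : A.det = algebraMap F (v.adicCompletion F) (γ : Matrix (Fin 2) (Fin 2) F).det := by
    have h : A.det = AdelicGroupData.finiteAdeleEval F v Y.det := by
      rw [RingHom.map_det]; rfl
    rw [h, hYdet]; rfl
  -- the valuation estimates from the Iwahori conditions
  have hr1 : min (WithZero.exp (-(r : ℤ)) : WithZero (Multiplicative ℤ))
      (WithZero.exp (-((max r 1 : ℕ) : ℤ))) ≤ WithZero.exp (-(r : ℤ)) := min_le_left _ _
  have hVtr : Valued.v (algebraMap F (v.adicCompletion F) (γ : Matrix (Fin 2) (Fin 2) F).trace - 2) ≤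
      WithZero.exp (-(r : ℤ)) := by
    rw [← hAtr, Matrix.trace_fin_two,
      show A 0 0 + A 1 1 - 2 = (A 0 0 - 1) + (A 1 1 - 1) by ring]
    exact Valued.v.map_add_le (hA.diag 0) (hA.diag 1)
  have hVdet : Valued.v (algebraMap F (v.adicCompletion F) (γ : Matrix (Fin 2) (Fin 2) F).det - 1) ≤
      WithZero.exp (-(r : ℤ)) := by
    rw [← hAdet, Matrix.det_fin_two,
      show A 0 0 * A 1 1 - A 0 1 * A 1 0 - 1 = (A 0 0 - 1) * A 1 1 + (A 1 1 - 1) - A 0 1 * A 1 0 by ring]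
    refine Valued.v.map_sub_le (Valued.v.map_add_le ?_ (hA.diag 1)) ?_
    · rw [map_mul]
      simpa using mul_le_mul' (hA.diag 0) (hA.le_one 1 1)
    · rw [map_mul]
      simpa using mul_le_mul' (hA.le_one 0 1) ((hA.lower 1 0 (by decide)).trans hr1)
  -- an element of `W` congruent to `c` modulo `𝔭_v^r`, `r ≥ r₀`, equals `c`
  have hval : ∀ d : F, Valued.v (algebraMap F (v.adicCompletion F) d) = v.valuation F d := fun d =>
    HeightOneSpectrum.valuedAdicCompletion_eq_valuation' v d
  have htr : (γ : Matrix (Fin 2) (Fin 2) F).trace = 2 := by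
    by_contra hne
    have hdD : (γ : Matrix (Fin 2) (Fin 2) F).trace - 2 ∈ D :=
      Or.inl ⟨_, trace_mem_of_pow_eq_one hm hγm', rfl⟩
    have hlt := hr₀ _ hdD (sub_ne_zero.2 hne)
    rw [← hval, map_sub, map_ofNat] at hlt
    exact lt_irrefl _ (hlt.trans_le (hρ _ hVtr))
  have hdet : (γ : Matrix (Fin 2) (Fin 2) F).det = 1 := by
    by_contra hne
    have hdD : (γ : Matrix (Fin 2) (Fin 2) F).det - 1 ∈ D :=
      Or.inr ⟨_, det_mem_of_pow_eq_one hm hγm', rfl⟩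
    have hlt := hr₀ _ hdD (sub_ne_zero.2 hne)
    rw [← hval, map_sub, map_one] at hlt
    exact lt_irrefl _ (hlt.trans_le (hρ _ hVdet))
  exact Units.ext (eq_one_of_pow_eq_one_of_trace_eq_two_of_det_eq_one hm hγm' htr hdet)

end BigHeckeGLn.TameLevel

end Literature.NumberTheory.Automorphic
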